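import Summits.ResolutionOfSingularities.ResolutionOfSingularities.Theorems.PAlterationAssemblyLevels
import Summits.ResolutionOfSingularities.ResolutionOfSingularities.Theorems.PAlterationAssemblyEmbedding
import Summits.ResolutionOfSingularities.ResolutionOfSingularities.Theorems.PAlterationAssemblySquares
import Literature.AlgebraicGeometry.Resolution.ChowLemmaProofs
import Mathlib.AlgebraicGeometry.Morphisms.FlatDescent
import HarnessLib

/-!
# `PAlteration.Assembly` (stmt-ResolutionOfSingularities-0553): a regular model at a full Frobenius level

Route `ResolutionOfSingularities/pAlteration`, item `Assembly` (stmt-0553); helper file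
(`--supports`). Conclusion of the descent in Theorem B (`exists_level_model`): under the thesis
at `p`, for an integral separated `k`-scheme `X` of finite type (`char k = p`) there are a full
level `k_n = k^{p^{-n}} ⊆ K = k^{p^{-∞}}`, an integral REGULAR scheme `R_n` and a proper surjective
`ρ_n : R_n → X_n = Spec k_n ×_k X` which is birational onto its scheme-theoretic image.

Proof. Resolve `X^∞ = (Spec K ×_k X)_red` over the perfect field `K` (Theorem A,
`exists_resolution_perfectClosure`): `π : R → X^∞`. Embed `R ↪ Spec K ×_k Q`
(`exists_closedImmersion_baseChange`) and descend to a full level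
(`exists_level_model_of_closedImmersion`): `R = Spec K ×_{k_n} R_n`, `R_n ↪ Spec k_n ×_k Q`. Then
`ρ_n : R_n → X_n` base-changes along the faithfully flat universal homeomorphism
`Spec K ×_{k_n} X_n ≅ X_K → X_n` to `R → X_K`: regularity and integrality of `R_n` and universal
closedness of `ρ_n` descend (Matsumura 23.7 (i); fpqc descent, Mathlib `DescendsAlong`); the
image `S_n` of `ρ_n` base-changes to the reduced `X^∞` (scheme-theoretic dominance is stable under
flat base change), so `R = X^∞ ×_{S_n} R_n` and birationality of `R_n → S_n` follows from that of
`π` by fpqc descent of isomorphisms over a dense open.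
-/

-- single-problem summit: the doubled namespace component `ResolutionOfSingularities` is forced
set_option linter.dupNamespace false

noncomputable section

open CategoryTheory CategoryTheory.Limits AlgebraicGeometry TopologicalSpace Topology

open Literature.AlgebraicGeometry.Resolution Scheme.IdealSheafData

namespace Summit.ResolutionOfSingularities.ResolutionOfSingularities.Theorems

/-- `Spec` of an extension of fields is flat. [folklore] -/
theorem flat_specMap_of_field {L K : Type} [Field L] [Field K] (i : L →+* K) :
    Flat (Spec.map (CommRingCat.ofHom i)) := by
  rw [HasRingHomProperty.Spec_iff (P := @Flat)]
  letI := i.toAlgebra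
  change (algebraMap L K).Flat
  rw [RingHom.flat_algebraMap_iff]
  infer_instance

/-- A dominant morphism with closed range is surjective. [folklore] -/
theorem surjective_of_isDominant_of_universallyClosed {X Y : Scheme.{0}} (f : X ⟶ Y) [IsDominant f]
    [UniversallyClosed f] : Surjective f :=
  ⟨fun y => by
    have : y ∈ closure (Set.range f.base) := f.denseRange.closure_range ▸ Set.mem_univ y
    rwa [f.isClosedMap.isClosed_range.closure_eq] at this⟩

-- as in Mathlib's pullback API for schemes
set_option backward.isDefEq.respectTransparency false in
/-- **A regular model at a full Frobenius level** (see the module docstring). [folklore] -/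
theorem exists_level_model (p : ℕ) [Fact p.Prime]
    (hPI : ∀ (k : Type) [Field k] [CharP k p] (X : Scheme.{0}) (f : X ⟶ Spec (.of k)),
      IsSeparated f → LocallyOfFiniteType f → QuasiCompact f → IsIntegral X →
      ∃ (X' : Scheme.{0}) (g : X' ⟶ X), IsProper g ∧ IsIntegral X' ∧ Scheme.IsRegular X' ∧
        Function.Surjective g.base ∧ ∃ U : X.Opens, Dense (U : Set X) ∧ IsFinite (g ∣_ U) ∧
        UniversallyInjective (g ∣_ U))
    (hPC : ∀ (k : Type) [Field k] [CharP k p] (Y X : Scheme.{0}) (f : Y ⟶ Spec (.of k))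
      (g : X ⟶ Y), IsSeparated f → LocallyOfFiniteType f → QuasiCompact f → IsIntegral Y →
      Scheme.IsRegular Y → IsIntegral X → IsFinite g → UniversallyInjective g →
      Function.Surjective g.base → Scheme.HasResolution X)
    {k : Type} [Field k] [CharP k p] {X : Scheme.{0}} (f : X ⟶ Spec (.of k))
    [IsSeparated f] [LocallyOfFiniteType f] [QuasiCompact f] [IsIntegral X] :
    ∃ (n : ℕ) (Rn : Scheme.{0}) (ρn : Rn ⟶ pullback (Spec.map (CommRingCat.ofHom
        ((PerfectClosure.of k p).codRestrict
          (Subfield.comap (iterateFrobenius (PerfectClosure k p) p n) (PerfectClosure.of k p).fieldRange)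
          (of_mem_level p k n)))) f),
      IsIntegral Rn ∧ Scheme.IsRegular Rn ∧ IsProper ρn ∧ Surjective ρn ∧ IsBirational ρn.toImage := by
  -- ### the resolution over the perfect closure
  have hres := exists_resolution_perfectClosure p f Fact.out hPI hPC
  obtain ⟨hXinf, hres2⟩ := hres
  obtain ⟨R, π₀, hπP, hπB, hRreg, hRint⟩ := hres2
  haveI := hXinf
  haveI := hπP
  haveI := hRint
  -- ### embedding and descent to a full level
  obtain ⟨Q, prX, m₀, hQqc, hQsep, hQlft, hm, hprX, hm1, hm2⟩ := exists_closedImmersion_baseChange p f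
    (π₀ ≫ (vanishingIdeal (⊤ : Closeds
      ↑(pullback (Spec.map (CommRingCat.ofHom (PerfectClosure.of k p))) f))).subschemeι)
  haveI := hQqc; haveI := hQsep; haveI := hQlft; haveI := hm
  obtain ⟨n, Rn, ιRn₀, e, hιRn, SqRm₀, he₀⟩ := exists_level_model_of_closedImmersion p Q m₀
  haveI := hιRn
  -- ### notation: aliases with explicit types (all definitional)
  let σK : CommRingCat.of k ⟶ CommRingCat.of (PerfectClosure k p) :=
    CommRingCat.ofHom (PerfectClosure.of k p)
  let XK := pullback (Spec.map σK) f
  let Xinf := (vanishingIdeal (⊤ : Closeds ↑XK)).subscheme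
  let ι₀ : Xinf ⟶ XK := (vanishingIdeal (⊤ : Closeds ↑XK)).subschemeι
  let π : R ⟶ Xinf := π₀
  haveI : IsProper π := hπP
  have hπB' : IsBirational π := hπB
  haveI : IsDominant π := hπB'.isDominant
  haveI : IsSchemeTheoreticallyDominant π := .of_isDominant π
  let ρ : R ⟶ XK := π ≫ ι₀
  haveI : IsProper ρ := inferInstanceAs (IsProper (π ≫ ι₀))
  let L := Subfield.comap (iterateFrobenius (PerfectClosure k p) p n) (PerfectClosure.of k p).fieldRange
  let ιn : k →+* L := (PerfectClosure.of k p).codRestrict L (of_mem_level p k n)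
  let ιL : L →+* PerfectClosure k p := L.subtype
  have hιLιn : σK = CommRingCat.ofHom ιn ≫ CommRingCat.ofHom ιL := by ext y; rfl
  let Xn := pullback (Spec.map (CommRingCat.ofHom ιn)) f
  let Qn := pullback (Spec.map (CommRingCat.ofHom ιn)) Q.hom
  let m : R ⟶ pullback (Spec.map σK) Q.hom := m₀
  haveI : IsClosedImmersion m := hm
  let ιRn : Rn ⟶ Qn := ιRn₀
  haveI : IsClosedImmersion ιRn := hιRn
  have SqRm : IsPullback (m ≫ pullback.fst _ _) e (Spec.map (CommRingCat.ofHom ιL))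
      (ιRn ≫ pullback.fst _ _) := SqRm₀
  have he : e ≫ ιRn ≫ pullback.snd _ _ = m ≫ pullback.snd _ _ := he₀
  have hm1' : m ≫ pullback.fst _ _ = ρ ≫ pullback.fst _ _ := hm1
  have hm2' : m ≫ pullback.snd _ _ ≫ prX = ρ ≫ pullback.snd _ _ := hm2
  -- ### the level objects
  let qX : Qn ⟶ Xn := pullback.map _ _ _ _ (𝟙 _) prX (𝟙 _) (by simp) (by rw [Category.comp_id, hprX])
  let ρn : Rn ⟶ Xn := ιRn ≫ qX
  have hρnfst : ρn ≫ pullback.fst _ _ = ιRn ≫ pullback.fst _ _ := by simp [ρn, qX]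
  have hρnsnd : ρn ≫ pullback.snd _ _ = ιRn ≫ pullback.snd _ _ ≫ prX := by simp [ρn, qX]
  -- `XK'' = Spec K ×_{k_n} Xn ≅ XK`
  let XK'' := pullback (Spec.map (CommRingCat.ofHom ιL)) (pullback.fst (Spec.map (CommRingCat.ofHom ιn)) f)
  let snd'' : XK'' ⟶ Xn := pullback.snd _ _
  haveI hflatL : Flat (Spec.map (CommRingCat.ofHom ιL)) := flat_specMap_of_field ιL
  haveI hsurjL : Surjective (Spec.map (CommRingCat.ofHom ιL)) := surjective_specMap_field ιL
  have hradL : ∀ x : PerfectClosure k p, ∃ (n : ℕ) (y : L), ιL y = x ^ p ^ n := fun x => by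
    obtain ⟨n', y, hy⟩ := perfectClosure_pow_mem p x
    exact ⟨n', ⟨PerfectClosure.of k p y, of_mem_level p k n y⟩, hy⟩
  haveI huiL : UniversallyInjective (Spec.map (CommRingCat.ofHom ιL)) :=
    universallyInjective_specMap_field_of_pow_mem ιL p hradL
  haveI hintL : IsIntegralHom (Spec.map (CommRingCat.ofHom ιL)) :=
    isIntegralHom_specMap_of_pow_mem ιL p hradL
  haveI : Flat snd'' := MorphismProperty.pullback_snd _ _ hflatL
  haveI : Surjective snd'' := MorphismProperty.pullback_snd _ _ hsurjL
  haveI : UniversallyInjective snd'' := universallyInjective_pullback_snd _ _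
  haveI : UniversallyClosed snd'' := MorphismProperty.pullback_snd _ _ inferInstance
  haveI : QuasiCompact snd'' := inferInstance
  have hcondXK : pullback.snd (Spec.map σK) f ≫ f = pullback.fst _ _ ≫ Spec.map σK :=
    pullback.condition.symm
  have hcondXn : pullback.snd (Spec.map (CommRingCat.ofHom ιn)) f ≫ f =
      pullback.fst _ _ ≫ Spec.map (CommRingCat.ofHom ιn) := pullback.condition.symm
  have hcond'' : snd'' ≫ pullback.fst _ _ = pullback.fst _ _ ≫ Spec.map (CommRingCat.ofHom ιL) :=
    pullback.condition.symm
  let eXK : XK'' ⟶ XK := pullback.lift (pullback.fst _ _) (snd'' ≫ pullback.snd _ _) (by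
    rw [Category.assoc, hcondXn, ← Category.assoc, hcond'', Category.assoc, ← Spec.map_comp, ← hιLιn])
  let dXn : XK ⟶ Xn := pullback.lift (pullback.fst _ _ ≫ Spec.map (CommRingCat.ofHom ιL))
    (pullback.snd _ _) (by rw [Category.assoc, ← Spec.map_comp, ← hιLιn, hcondXK])
  let dXK : XK ⟶ XK'' := pullback.lift (pullback.fst _ _) dXn (by simp [dXn])
  have hed : eXK ≫ dXK = 𝟙 _ := by
    apply pullback.hom_ext
    · simp [eXK, dXK]
    · apply pullback.hom_ext
      · simpa [eXK, dXK, dXn] using hcond''.symm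
      · simp [eXK, dXK, dXn, snd'']
  have hde : dXK ≫ eXK = 𝟙 _ := by
    apply pullback.hom_ext
    · simp [eXK, dXK]
    · simp [eXK, dXK, dXn, snd'']
  haveI : IsIso eXK := ⟨dXK, hed, hde⟩
  haveI : IsIso dXK := ⟨eXK, hde, hed⟩
  -- ### `ρK : R → XK''` and the key cartesian square `R = XK'' ×_{Xn} Rn`
  let gR := m ≫ pullback.fst (Spec.map σK) Q.hom
  let ρK : R ⟶ XK'' := pullback.lift gR (e ≫ ρn)
    (by rw [Category.assoc e ρn, hρnfst]; exact SqRm.w)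
  have SqX : IsPullback e ρK ρn snd'' := by
    refine IsPullback.of_bot (v₂₁ := pullback.fst _ _) (v₂₂ := pullback.fst _ _)
      (h₃₁ := Spec.map (CommRingCat.ofHom ιL)) ?_ (pullback.lift_snd _ _ _).symm
      (IsPullback.of_hasPullback _ _).flip
    rw [pullback.lift_fst, hρnfst]
    exact SqRm.flip
  have hρKe : ρK ≫ eXK = ρ := by
    apply pullback.hom_ext
    · simp only [ρK, eXK, gR, Category.assoc, pullback.lift_fst]
      rw [hm1']
    · simp only [ρK, eXK, snd'', Category.assoc, pullback.lift_snd, pullback.lift_snd_assoc]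
      rw [hρnsnd, reassoc_of% he, hm2']
  have hρK : ρK = ρ ≫ dXK := by
    rw [← hρKe, Category.assoc, hed, Category.comp_id]
  haveI : UniversallyClosed ρK := by rw [hρK]; infer_instance
  haveI : QuasiCompact ρK := by rw [hρK]; infer_instance
  -- ### properties of `R_n` and `ρ_n`
  haveI : Flat e := MorphismProperty.of_isPullback (P := @Flat) SqRm hflatL
  haveI : Surjective e := MorphismProperty.of_isPullback (P := @Surjective) SqRm hsurjL
  haveI : IsLocallyNoetherian Rn :=
    LocallyOfFiniteType.isLocallyNoetherian (ιRn ≫ pullback.fst (Spec.map (CommRingCat.ofHom ιn)) Q.hom)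
  have hRnreg : Scheme.IsRegular Rn := isRegular_of_flat_surjective e hRreg
  haveI hRnint : IsIntegral Rn := isIntegral_of_flat_surjective e
  have hQ : (@Surjective ⊓ @Flat ⊓ @QuasiCompact : MorphismProperty Scheme) snd'' :=
    ⟨⟨inferInstance, inferInstance⟩, inferInstance⟩
  haveI : UniversallyClosed ρn :=
    MorphismProperty.of_isPullback_of_descendsAlong (P := @UniversallyClosed) SqX.flip hQ inferInstance
  haveI : IsSeparated (qX ≫ pullback.fst _ _) := by
    have : qX ≫ pullback.fst _ _ = pullback.fst _ _ := by simp [qX]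
    rw [this]; infer_instance
  haveI : IsSeparated qX := IsSeparated.of_comp qX (pullback.fst _ _)
  haveI : IsSeparated ρn := inferInstanceAs (IsSeparated (ιRn ≫ qX))
  haveI : LocallyOfFiniteType (ρn ≫ pullback.fst _ _) := by rw [hρnfst]; infer_instance
  haveI : LocallyOfFiniteType ρn := locallyOfFiniteType_of_comp ρn (pullback.fst _ _)
  haveI hρnP : IsProper ρn := ⟨⟩
  have hρnsurj : Surjective ρn := by
    haveI : Surjective π := surjective_of_isDominant_of_universallyClosed π
    haveI : Surjective ρ := inferInstanceAs (Surjective (π ≫ ι₀))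
    haveI : Surjective (ρK ≫ snd'') := by rw [hρK]; infer_instance
    haveI : Surjective (e ≫ ρn) := by rw [SqX.w]; infer_instance
    exact Surjective.of_comp e ρn
  refine ⟨n, Rn, ρn, hRnint, hRnreg, hρnP, hρnsurj, ?_⟩
  -- ### birationality of `R_n → S_n` (`S_n` the scheme-theoretic image)
  let Sn := ρn.image
  let jn : Sn ⟶ Xn := ρn.imageι
  let πn : Rn ⟶ Sn := ρn.toImage
  haveI : IsSchemeTheoreticallyDominant πn := ChowLemmaProof.isSchemeTheoreticallyDominant_toImage ρn
  -- `T = S_n ×_{X_n} XK''` and `R = R_n ×_{S_n} T`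
  let T := pullback jn snd''
  let fstT : T ⟶ Sn := pullback.fst jn snd''
  let sndT : T ⟶ XK'' := pullback.snd jn snd''
  haveI : Flat fstT := MorphismProperty.pullback_fst _ _ inferInstance
  haveI : Surjective fstT := MorphismProperty.pullback_fst _ _ inferInstance
  haveI : QuasiCompact fstT := MorphismProperty.pullback_fst _ _ inferInstance
  haveI : UniversallyClosed fstT := MorphismProperty.pullback_fst _ _ inferInstance
  haveI : UniversallyInjective fstT :=
    MorphismProperty.pullback_fst (P := @UniversallyInjective) _ _ inferInstance
  let uR : R ⟶ T := pullback.lift (e ≫ πn) ρK (by rw [Category.assoc, Scheme.Hom.toImage_imageι]; exact SqX.w)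
  have SqT : IsPullback uR e fstT πn :=
    IsPullback.of_right (h₁₂ := sndT) (v₁₃ := snd'') (h₂₂ := jn)
      (by rw [pullback.lift_snd, Scheme.Hom.toImage_imageι]; exact SqX.flip)
      (pullback.lift_fst _ _ _) (IsPullback.of_hasPullback jn snd'').flip
  haveI : IsSchemeTheoreticallyDominant uR := IsSchemeTheoreticallyDominant.of_isPullback SqT.flip
  haveI : QuasiCompact (uR ≫ sndT) := by rw [pullback.lift_snd]; infer_instance
  haveI : QuasiCompact uR := QuasiCompact.of_comp uR sndT
  haveI : IsReduced T := IsSchemeTheoreticallyDominant.isReduced uR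
  -- `X^∞ ≅ T`
  let ι₀K : Xinf ⟶ XK'' := ι₀ ≫ dXK
  haveI : IsClosedImmersion ι₀K := inferInstance
  have hfac : π ≫ ι₀K ≫ snd'' = e ≫ ρn := by
    rw [SqX.w, hρK]; simp [ι₀K, ρ]
  have hker : ρn.ker ≤ (ι₀K ≫ snd'').ker := by
    intro U s hs
    rw [Scheme.Hom.ker_apply] at hs ⊢
    apply π.app_injective
    rw [map_zero]
    change (π ≫ ι₀K ≫ snd'').app U s = 0
    rw [hfac]
    change e.app _ (ρn.app U s) = 0
    rw [RingHom.mem_ker.mp hs, map_zero]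
  let v : Xinf ⟶ Sn := (ι₀K ≫ snd'').toImage ≫ inclusion hker
  have hv : v ≫ jn = ι₀K ≫ snd'' := by
    simp only [v, jn, Category.assoc, Scheme.Hom.imageι, inclusion_subschemeι, Scheme.Hom.toImage_imageι]
  let uT : Xinf ⟶ T := pullback.lift v ι₀K hv
  haveI : IsClosedImmersion (uT ≫ sndT) := by rw [pullback.lift_snd]; infer_instance
  haveI : IsClosedImmersion uT := IsClosedImmersion.of_comp uT sndT
  haveI : Surjective uT := ⟨fun tt => by
    obtain ⟨x, hx⟩ := (inferInstance : Surjective ι₀K).1 (sndT.base tt)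
    refine ⟨x, sndT.isClosedEmbedding.injective ?_⟩
    rw [← Scheme.Hom.comp_apply, pullback.lift_snd, hx]⟩
  haveI : IsIso uT := isIso_of_isClosedImmersion_of_surjective uT
  have huR : uR = π ≫ uT := by
    apply pullback.hom_ext
    · rw [← cancel_mono jn]
      simp only [uR, uT, πn, jn, Category.assoc, pullback.lift_fst, hv, Scheme.Hom.toImage_imageι]
      exact hfac.symm
    · simp only [uR, uT, Category.assoc, pullback.lift_snd, hρK]
      rfl
  have SqS : IsPullback π e v πn := by
    refine IsPullback.of_iso SqT (Iso.refl _) (asIso uT).symm (Iso.refl _) (Iso.refl _) ?_ ?_ ?_ ?_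
    · rw [Iso.refl_hom, Category.id_comp, huR, Iso.symm_hom, asIso_inv, Category.assoc,
        IsIso.hom_inv_id, Category.comp_id]
    · simp
    · rw [Iso.refl_hom, Category.comp_id, Iso.symm_hom, asIso_inv, IsIso.eq_inv_comp]
      exact pullback.lift_fst _ _ _
    · simp
  -- `v` is faithfully flat and a homeomorphism
  have hvT : v = uT ≫ fstT := (pullback.lift_fst _ _ _).symm
  haveI : Flat v := by rw [hvT]; infer_instance
  haveI : Surjective v := by rw [hvT]; infer_instance
  haveI : QuasiCompact v := by rw [hvT]; infer_instance
  have hvh : IsHomeomorph v.base := by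
    have h1 : IsHomeomorph fstT.base :=
      isHomeomorph_of_universallyClosed_of_universallyInjective fstT
    have h2 : IsHomeomorph uT.base := (Scheme.homeoOfIso (asIso uT)).isHomeomorph
    rw [hvT, Scheme.Hom.comp_base]
    exact h1.comp h2
  -- the dense open
  obtain ⟨U, hU, -, hisoU⟩ := hπB'
  let Un : Sn.Opens := ⟨v.base '' (U : Set Xinf), hvh.isOpenMap _ U.2⟩
  have hUeq : v ⁻¹ᵁ Un = U := Opens.ext (Set.preimage_image_eq _ hvh.injective)
  haveI : IrreducibleSpace T := irreducibleSpace_of_surjective uT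
  haveI : IrreducibleSpace Sn := irreducibleSpace_of_surjective fstT
  obtain ⟨u₀, hu₀⟩ := hU.nonempty
  haveI : Surjective πn := surjective_toImage_of_universallyClosed ρn
  refine ⟨Un, Un.2.dense ⟨v.base u₀, u₀, hu₀, rfl⟩, (πn ⁻¹ᵁ Un).2.dense ?_, ?_⟩
  · obtain ⟨r, hr⟩ := πn.surjective (v.base u₀)
    exact ⟨r, show πn.base r ∈ Un from hr ▸ ⟨u₀, hu₀, rfl⟩⟩
  obtain ⟨eW, -, SqW⟩ := IsPullback.exists_restrict SqS Un
  have hisoU' : (MorphismProperty.isomorphisms Scheme) (π ∣_ (v ⁻¹ᵁ Un)) :=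
    ((MorphismProperty.isomorphisms Scheme).arrow_mk_iso_iff (morphismRestrictEq π hUeq)).mpr
      ((MorphismProperty.isomorphisms.iff _).mpr hisoU)
  have hQ' : (@Surjective ⊓ @Flat ⊓ @QuasiCompact : MorphismProperty Scheme) (v ∣_ Un) :=
    ⟨⟨IsZariskiLocalAtTarget.restrict ‹Surjective v› Un, inferInstance⟩, inferInstance⟩
  exact (MorphismProperty.isomorphisms.iff _).mp
    (MorphismProperty.of_isPullback_of_descendsAlong (P := MorphismProperty.isomorphisms Scheme)
      SqW hQ' hisoU')

end Summit.ResolutionOfSingularities.ResolutionOfSingularities.Theorems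

end
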